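import Summits.QuantumFields.BalabanUV.T4Continuum.Support.RegionGaugeProjection
import Summits.QuantumFields.BalabanUV.T4Continuum.Support.GaugeTermTwoLevelNumbers
import Summits.QuantumFields.BalabanUV.T4Continuum.Support.RegionNormPairingTools

/-!
# T⁴ programme, spine node NE2 (U1a), sub-row Δ1 «NE2⁰-Dirichlet» — O14-b′ piece (P-gauge) «W3-GAUGE-PAIRING», file A:
# THE TWO-LEVEL LAW OF THE GAUGE PROJECTION `P = G′Q′ᴴ(Q′G′²Q′ᴴ)⁻¹Q′G′` AGAINST THE SCALAR PLANTING, generic finite matrices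

NE2 formalisation swarm `b2b-balaban-t4-ne2-formalise-*`, LEAF PROVER 05 (gen 9), supplier item «W3-GAUGE-PAIRING» = piece (P-gauge) of the
row-NE2 owner's located analytic item O14-b′ «W3-BOX-COMPRESSED» (rulings R33 (c) / R34 (b), journal `CLAIMS.log` 2026-08-20 l.20955 /
l.21267; guidance `t4/T4-EST-NE2-P1.md` v10.33 (G): «(P-gauge) NONLOCAL: `∂_ΩP(Ω₀)∂_Ωᴴ` at two levels, `P = G′Q′ᴴK⁻¹Q′G′` — needs the
scalar box two-level law for `G′(Ω₀)`, uniform `σ₀`-bounds for `K`, `K⁻¹`, and the planting/gradient intertwining defect»).  In the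
owner's socket `RegionStarInjectedPairing.hinj_of_pairing` (p235609) the GAUGE part of leaf-02-g7's three-socket split
`GaugeFixedPairingSplit.commutator_pairing_split` (p235926) reads `⟨∂ᴴJᴴx, R·∂ᴴy⟩ − ⟨∂′ᴴx, R′·∂′ᴴJy⟩`, `R = 1 − P`
([Balaban1985BackgroundPropagators] (3.25) p.394 «R = I − G′Q′*(Q′G′²Q′*)⁻¹Q′G′» — SHAPE only; `RegionGaugeProjection.gaugeR/gaugeP`,
owner O12-c p221022).  R34 (b) moved the LOCAL part `∂_Ω∂_Ωᴴ` into (P-gaffney); (P-gauge) is the `P`-part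

  `T(x,y) := ⟨∂ᴴJᴴx, P·∂ᴴy⟩ − ⟨∂′ᴴx, P′·∂′ᴴJy⟩`.

THIS FILE is the generic algebra of (P-gauge) over finite matrices (no lattice): with the SCALAR planting `J₀` (fine ← coarse scalars) and
the two planting/divergence INTERTWINING DEFECTS `Θy := ∂′ᴴJy − J₀∂ᴴy`, `Θ̃x := ∂ᴴJᴴx − J₀ᴴ∂′ᴴx` as vectors,

 * §1 `projY Y := Yᴴ(YYᴴ)⁻¹Y` and **`gaugeP_eq_projY`**: `gaugeP G Q = projY (Q·G)` for Hermitian `G`; `projY (c•Y) = projY Y`;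
 * §2 **`pairing_split`** (exact): `T = ⟨∂′ᴴx, (J₀P − P′J₀)·∂ᴴy⟩ + ⟨Θ̃x, P·∂ᴴy⟩ − ⟨P′·∂′ᴴx, Θy⟩` (`P′` Hermitian) and its norm form
   **`norm_pairing_le`**: `‖T‖ ≤ ‖P′J₀ − J₀P‖·√nsq(∂′ᴴx)·√nsq(∂ᴴy) + ‖⟨Θ̃x, P∂ᴴy⟩‖ + ‖⟨P′∂′ᴴx, Θy⟩‖` — the divergence BUDGETS times an
   OPERATOR-norm two-level number, plus the two defect pairings against the REGULAR functions `P∂ᴴy`, `P′∂′ᴴx ∈ range(G′Q′ᴴ)` (files C/D);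
 * §3 **`projY_twoLevel_split`** (exact): `P′J₀ − J₀P = J₀Yᴴ(N′ − N)Y + (Y′ᴴ − J₀Yᴴ)N′Y + Y′ᴴN′(Y′J₀ − Y)` (`N = (YYᴴ)⁻¹`), and
   **`opNorm_projY_twoLevel_le`**: with `Y = Q·G`, `Y′ = Q′·G′`, the EXACT averaging/planting pairing `Q′J₀ = Q`, `‖J₀‖ ≤ 1`, the scalar
   injected number `‖G′J₀ − J₀G‖ ≤ es`, the scalar complement number `‖G′(1 − J₀J₀ᴴ)‖ ≤ ec`, sizes `‖Q′‖ ≤ q`, `‖G‖, ‖G′‖ ≤ g` and the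
   unit-layer bounds `‖(YYᴴ)⁻¹‖, ‖(Y′Y′ᴴ)⁻¹‖ ≤ nK`:
   `‖P′J₀ − J₀P‖ ≤ CPtwo q g nK E·(es + ec)`, `CPtwo q g nK E := q²g·nK·(2 + q²g·nK·(2g + E))` (`E` any level-free cap of `es`) — LINEAR in the scalar tower's two numbers
   (lineage B4.b pattern `GaugeTermTwoLevelNumbers.opNorm_gramK_twoLevel_le` / `outer_E_le` BY NAME, now two-level in `k` at `U = 1` instead
   of two-background at fixed `k`).

OWNER RE-CUT O15-a «Δ1-VEC-W3-RESOLVENT-SPLIT» (owner gen 15, journal l.21857, three minutes after this item's INTENT l.21834): the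
resolvent identity `G = G̃ + G·(∂P∂ᴴ)·G̃` (`G̃ = Δ_loc⁻¹`) DISSOLVES the pairing formulation of (P-gauge) into OPERATOR-norm leaves; of
those, (W-c) «`‖KcompR_{k+1}⁻¹ − KcompR_k⁻¹‖ ≤ C·L^{−k}`» is §3's **`opNorm_inv_gramK_sub_twoLevel_le`** read with the ISOMETRIC averaging
`Y_k = (n_k^{d/2}•QOm_k)·GOm_k` (`KcompR = YYᴴ`, `(n_{k+1}^{d/2}•QOm_{k+1})·J₀ = n_k^{d/2}•QOm_k` exactly) — the box instance is the next
file of this item; §2 is kept as the budget-currency record.  (W-b) (the outer factors `B̂ = ∂G′Q̂ᴴ` at two levels) is NOT touched here.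

HONEST FRAMING (T4-DAG p. 1).  [folklore] bookkeeping over finite matrices in the `ℓ²` operator norm, statements and constants OURS; when
instantiated: `U = 1`, ONE region, ONE averaging scale, finite torus; NOT [B9] (3.23)–(3.27) as printed ([B9] prints η-uniform bounds, no
two-spacing law); W3 on boxes OPEN; NE2 (U1a) NOT proved; spine PROVED 0/9 unchanged; NOT infinite volume / mass gap / Clay.  HONEST
DEPENDENCY: continuum YM on T⁴ ⇐ BetaPertH ∧ nine spine estimates (0/9 proved); BetaPertH ⇐ (D1) ∧ (D4) ∧ CAP+tail; G-an2-4 gates asym, D1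
and NE2/3/4.  No `sorry`.
-/

noncomputable section

open scoped BigOperators ComplexConjugate Matrix Matrix.Norms.L2Operator

namespace Summit.QuantumFields.BalabanUV.T4Continuum.GaugeProjectionTwoLevel

open Literature.MathematicalPhysics.QuantumFieldTheory.Balaban1983to89.B5Prop11Lower (nsq nsq_nonneg norm_star_dotProduct_le)
open Literature.MathematicalPhysics.QuantumFieldTheory.Balaban1983to89.B5Action121 (star_mulVec_dotProduct)
open Summit.QuantumFields.BalabanUV.T4Continuum
open Summit.QuantumFields.BalabanUV.T4Continuum.RegionGaugeProjection (gramK gaugeP)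
open Summit.QuantumFields.BalabanUV.T4Continuum.GaugeTermTwoLevelNumbers (opNorm_gramK_twoLevel_le outer_E_le
  opNorm_inv_sub_inv_le_of_isUnit)
open Summit.QuantumFields.BalabanUV.T4Continuum.RegionNormPairingTools (sqrt_nsq_mulVec_le)

variable {m m' u : Type*} [Fintype m] [DecidableEq m] [Fintype m'] [DecidableEq m'] [Fintype u] [DecidableEq u]

/-! ## §1 The projection as a sandwich of `Y = Q·G` -/

/-- `projY Y := Yᴴ·(Y·Yᴴ)⁻¹·Y` — the orthogonal projection onto `range(Yᴴ)` whenever `Y·Yᴴ` is invertible. [folklore] -/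
def projY (Y : Matrix u m ℂ) : Matrix m m ℂ := Yᴴ * (Y * Yᴴ)⁻¹ * Y

omit [DecidableEq m] [Fintype u] [DecidableEq u] in
/-- `K = Q·G·G·Qᴴ = (Q·G)·(Q·G)ᴴ` for Hermitian `G`. [folklore] -/
theorem gramK_eq_mul_conjTranspose {G : Matrix m m ℂ} (hG : G.IsHermitian) (Q : Matrix u m ℂ) :
    gramK G Q = (Q * G) * (Q * G)ᴴ := by
  unfold gramK
  rw [Matrix.conjTranspose_mul, hG.eq, Matrix.mul_assoc (Q * G)]

omit [DecidableEq m] in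
/-- **`P = projY (Q·G)`** for Hermitian `G`: (3.25)'s `G′Q′ᴴ(Q′G′²Q′ᴴ)⁻¹Q′G′` is the sandwich `Yᴴ(YYᴴ)⁻¹Y`, `Y = Q′G′`.
[cite: Balaban1985BackgroundPropagators, (3.25) p.394 (shape)] [folklore] -/
theorem gaugeP_eq_projY {G : Matrix m m ℂ} (hG : G.IsHermitian) (Q : Matrix u m ℂ) : gaugeP G Q = projY (Q * G) := by
  unfold projY gaugeP
  rw [← gramK_eq_mul_conjTranspose hG, Matrix.conjTranspose_mul, hG.eq]
  simp only [Matrix.mul_assoc]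

omit [DecidableEq m] in
/-- `projY` does not see a rescaling of `Y` (when `Y·Yᴴ` is invertible). [folklore] -/
theorem projY_smul {Y : Matrix u m ℂ} (hK : IsUnit (Y * Yᴴ).det) {c : ℂ} (hc : c ≠ 0) : projY (c • Y) = projY Y := by
  unfold projY
  have hcc : (star c * c) ≠ 0 := mul_ne_zero (star_ne_zero.mpr hc) hc
  have e1 : (c • Y) * (c • Y)ᴴ = (star c * c) • (Y * Yᴴ) := by
    rw [Matrix.conjTranspose_smul, Matrix.smul_mul, Matrix.mul_smul, smul_smul, mul_comm]
  have e2 : ((star c * c) • (Y * Yᴴ))⁻¹ = (star c * c)⁻¹ • (Y * Yᴴ)⁻¹ := by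
    refine Matrix.inv_eq_left_inv ?_
    rw [Matrix.smul_mul, Matrix.mul_smul, smul_smul, inv_mul_cancel₀ hcc, one_smul, Matrix.nonsing_inv_mul _ hK]
  rw [e1, e2, Matrix.conjTranspose_smul]
  simp only [Matrix.smul_mul, Matrix.mul_smul, smul_smul]
  have hsc : star c ≠ 0 := star_ne_zero.mpr hc
  have h1 : ∀ k : ℂ, k = 1 → k • (Yᴴ * (Y * Yᴴ)⁻¹ * Y) = Yᴴ * (Y * Yᴴ)⁻¹ * Y := fun k hk => by rw [hk, one_smul]
  refine h1 _ ?_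
  field_simp

/-! ## §2 The pairing split: divergence budgets × operator two-level number + two defect pairings -/

section Pairing

variable (P : Matrix m m ℂ) (P' : Matrix m' m' ℂ) (J₀ : Matrix m' m ℂ)

omit [DecidableEq m] [DecidableEq m'] in
/-- **THE EXACT SPLIT OF THE (P-gauge) PAIRING**: for `P′` Hermitian and any vectors `α` (= `∂ᴴy`), `β` (= `∂′ᴴx`), `t` (= `Θy`),
`tl` (= `Θ̃x`):  `⟨J₀ᴴβ + tl, Pα⟩ − ⟨β, P′(J₀α + t)⟩ = ⟨β, (J₀P − P′J₀)α⟩ + ⟨tl, Pα⟩ − ⟨P′β, t⟩`. [folklore] -/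
theorem pairing_split (hP' : P'.IsHermitian) (α tl : m → ℂ) (β t : m' → ℂ) :
    star (J₀ᴴ *ᵥ β + tl) ⬝ᵥ (P *ᵥ α) - star β ⬝ᵥ (P' *ᵥ (J₀ *ᵥ α + t))
      = star β ⬝ᵥ ((J₀ * P - P' * J₀) *ᵥ α) + star tl ⬝ᵥ (P *ᵥ α) - star (P' *ᵥ β) ⬝ᵥ t := by
  rw [star_add, add_dotProduct, Matrix.mulVec_add, dotProduct_add, Matrix.sub_mulVec, dotProduct_sub,
    ← Matrix.mulVec_mulVec, ← Matrix.mulVec_mulVec, star_mulVec_dotProduct J₀ᴴ β, Matrix.conjTranspose_conjTranspose,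
    star_mulVec_dotProduct P' β t, hP'.eq]
  ring

/-- **THE NORM FORM**: `‖T‖ ≤ ‖J₀P − P′J₀‖·√nsq β·√nsq α + ‖⟨tl, Pα⟩‖ + ‖⟨P′β, t⟩‖` — the divergence budgets pay for an OPERATOR-norm
two-level number; the two defect pairings are left to be bounded against the regular functions `Pα`, `P′β`. [folklore] -/
theorem norm_pairing_le (hP' : P'.IsHermitian) (α tl : m → ℂ) (β t : m' → ℂ) :
    ‖star (J₀ᴴ *ᵥ β + tl) ⬝ᵥ (P *ᵥ α) - star β ⬝ᵥ (P' *ᵥ (J₀ *ᵥ α + t))‖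
      ≤ ‖J₀ * P - P' * J₀‖ * Real.sqrt (nsq β) * Real.sqrt (nsq α) + ‖star tl ⬝ᵥ (P *ᵥ α)‖ + ‖star (P' *ᵥ β) ⬝ᵥ t‖ := by
  rw [pairing_split P P' J₀ hP']
  refine (norm_sub_le _ _).trans (add_le_add ((norm_add_le _ _).trans (add_le_add ?_ le_rfl)) le_rfl)
  calc ‖star β ⬝ᵥ ((J₀ * P - P' * J₀) *ᵥ α)‖
      ≤ Real.sqrt (nsq β) * Real.sqrt (nsq ((J₀ * P - P' * J₀) *ᵥ α)) := norm_star_dotProduct_le _ _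
    _ ≤ Real.sqrt (nsq β) * (‖J₀ * P - P' * J₀‖ * Real.sqrt (nsq α)) := by
        exact mul_le_mul_of_nonneg_left (sqrt_nsq_mulVec_le _ _) (Real.sqrt_nonneg _)
    _ = _ := by ring

end Pairing

/-! ## §3 The operator two-level number of the projection from the scalar tower's numbers -/

section TwoLevel

omit [DecidableEq m] [DecidableEq m'] [DecidableEq u] in
/-- **THE EXACT TWO-LEVEL SPLIT OF THE SANDWICH**: `Y′ᴴN′Y′J₀ − J₀YᴴNY = J₀Yᴴ(N′ − N)Y + (Y′ᴴ − J₀Yᴴ)N′Y + Y′ᴴN′(Y′J₀ − Y)`. [folklore] -/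
theorem sandwich_twoLevel_split (Y : Matrix u m ℂ) (Y' : Matrix u m' ℂ) (N N' : Matrix u u ℂ) (J₀ : Matrix m' m ℂ) :
    Y'ᴴ * N' * Y' * J₀ - J₀ * (Yᴴ * N * Y)
      = J₀ * Yᴴ * (N' - N) * Y + (Y'ᴴ - J₀ * Yᴴ) * N' * Y + Y'ᴴ * N' * (Y' * J₀ - Y) := by
  simp only [Matrix.mul_sub, Matrix.sub_mul, Matrix.mul_assoc]
  abel

omit [DecidableEq m] [DecidableEq m'] in
/-- the split for `projY`: `projY Y′·J₀ − J₀·projY Y = J₀Yᴴ(N′ − N)Y + (Y′ᴴ − J₀Yᴴ)N′Y + Y′ᴴN′(Y′J₀ − Y)`, `N = (YYᴴ)⁻¹`, `N′ = (Y′Y′ᴴ)⁻¹`.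
[folklore] -/
theorem projY_twoLevel_split (Y : Matrix u m ℂ) (Y' : Matrix u m' ℂ) (J₀ : Matrix m' m ℂ) :
    projY Y' * J₀ - J₀ * projY Y
      = J₀ * Yᴴ * ((Y' * Y'ᴴ)⁻¹ - (Y * Yᴴ)⁻¹) * Y + (Y'ᴴ - J₀ * Yᴴ) * (Y' * Y'ᴴ)⁻¹ * Y
        + Y'ᴴ * (Y' * Y'ᴴ)⁻¹ * (Y' * J₀ - Y) :=
  sandwich_twoLevel_split Y Y' _ _ J₀

omit [DecidableEq u] in
/-- the LEFT outer two-level error: with `Q′J₀ = Q`, `(Q′G′) − (QG)J₀ᴴ = Q′·(G′(1 − J₀J₀ᴴ) + (G′J₀ − J₀G)J₀ᴴ)`, so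
`‖Y′ − YJ₀ᴴ‖ ≤ q·(ec + es)` when `‖J₀‖ ≤ 1`. [folklore] -/
theorem opNorm_outer_left_le {Q : Matrix u m ℂ} {Q' : Matrix u m' ℂ} {G : Matrix m m ℂ} {G' : Matrix m' m' ℂ} {J₀ : Matrix m' m ℂ}
    (hQ : Q' * J₀ = Q) {q es ec : ℝ} (hQ' : ‖Q'‖ ≤ q) (hJ : ‖J₀‖ ≤ 1) (hes : ‖G' * J₀ - J₀ * G‖ ≤ es)
    (hec : ‖G' * (1 - J₀ * J₀ᴴ)‖ ≤ ec) : ‖Q' * G' - Q * G * J₀ᴴ‖ ≤ q * (ec + es) := by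
  have e : Q' * G' - Q * G * J₀ᴴ = Q' * (G' * (1 - J₀ * J₀ᴴ) + (G' * J₀ - J₀ * G) * J₀ᴴ) := by
    rw [← hQ]
    simp only [Matrix.mul_add, Matrix.mul_sub, Matrix.sub_mul, Matrix.mul_one, Matrix.mul_assoc]
    abel
  rw [e]
  have hq : 0 ≤ q := (norm_nonneg _).trans hQ'
  have hes0 : 0 ≤ es := (norm_nonneg _).trans hes
  refine (Matrix.l2_opNorm_mul _ _).trans (mul_le_mul hQ' ?_ (norm_nonneg _) hq)
  refine (norm_add_le _ _).trans (add_le_add hec ?_)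
  calc ‖(G' * J₀ - J₀ * G) * J₀ᴴ‖ ≤ ‖G' * J₀ - J₀ * G‖ * ‖J₀ᴴ‖ := Matrix.l2_opNorm_mul _ _
    _ ≤ es * 1 := by
        rw [Matrix.l2_opNorm_conjTranspose]
        exact mul_le_mul hes hJ (norm_nonneg _) hes0
    _ = es := mul_one es

/-- **THE UNIT-LAYER GRAM AT TWO LEVELS** (generic; O15-a (W-c) shape): with `Q′J₀ = Q`, `‖J₀‖ ≤ 1`, `‖Q′‖ ≤ q`, `‖G‖, ‖G′‖ ≤ g`, the scalar
injected number `‖G′J₀ − J₀G‖ ≤ es ≤ E` and complement number `‖G′(1 − J₀J₀ᴴ)‖ ≤ ec`: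
`‖(Q′G′)(Q′G′)ᴴ − (QG)(QG)ᴴ‖ ≤ q²(2g + E)·(es + ec)`. [folklore] -/
theorem opNorm_gramK_sub_twoLevel_le {Q : Matrix u m ℂ} {Q' : Matrix u m' ℂ} {G : Matrix m m ℂ} {G' : Matrix m' m' ℂ}
    {J₀ : Matrix m' m ℂ} (hQ : Q' * J₀ = Q) {q g es ec E : ℝ} (hQ' : ‖Q'‖ ≤ q) (hJ : ‖J₀‖ ≤ 1) (hG : ‖G‖ ≤ g) (hG' : ‖G'‖ ≤ g)
    (hes : ‖G' * J₀ - J₀ * G‖ ≤ es) (hec : ‖G' * (1 - J₀ * J₀ᴴ)‖ ≤ ec) (hesE : es ≤ E) :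
    ‖Q' * G' * (Q' * G')ᴴ - Q * G * (Q * G)ᴴ‖ ≤ q * q * (2 * g + E) * (es + ec) := by
  have hq : 0 ≤ q := (norm_nonneg _).trans hQ'
  have hg : 0 ≤ g := (norm_nonneg _).trans hG
  have hes0 : 0 ≤ es := (norm_nonneg _).trans hes
  have hec0 : 0 ≤ ec := (norm_nonneg _).trans hec
  have hE : 0 ≤ E := hes0.trans hesE
  have hQn : ‖Q‖ ≤ q := by
    rw [← hQ]
    calc ‖Q' * J₀‖ ≤ ‖Q'‖ * ‖J₀‖ := Matrix.l2_opNorm_mul _ _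
      _ ≤ q * 1 := mul_le_mul hQ' hJ (norm_nonneg _) hq
      _ = q := mul_one q
  have hY : ‖Q * G‖ ≤ q * g := (Matrix.l2_opNorm_mul _ _).trans (mul_le_mul hQn hG (norm_nonneg _) hq)
  have hY' : ‖Q' * G'‖ ≤ q * g := (Matrix.l2_opNorm_mul _ _).trans (mul_le_mul hQ' hG' (norm_nonneg _) hq)
  have h1 : ‖Q' * G' * J₀ - Q * G‖ ≤ q * es + 0 * g := outer_E_le hQ' hes (by rw [hQ, sub_self, norm_zero]) hG
  rw [zero_mul, add_zero] at h1
  have e1 : (q * es) * (q * es) ≤ q * q * E * es := by nlinarith [mul_nonneg (mul_nonneg hq hq) hes0, mul_le_mul_of_nonneg_left hesE hes0]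
  have hX : 2 * (q * g) * (q * es) + (q * es) * (q * es) + q * ec * (q * g) ≤ q * q * (2 * g + E) * (es + ec) := by
    have f1 : 0 ≤ q * q * g * ec := by positivity
    have f2 : 0 ≤ q * q * ec := by positivity
    have f3 : 0 ≤ q * q * E * ec := by positivity
    nlinarith [e1, f1, f2, f3]
  exact (opNorm_gramK_twoLevel_le hQ' h1 hec hY hY').trans hX

/-- **THE INVERSE UNIT-LAYER GRAM AT TWO LEVELS** (generic; O15-a (W-c) «‖K̂_{k+1}⁻¹ − K̂_k⁻¹‖» shape): if moreover both Grams are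
invertible with `‖((QG)(QG)ᴴ)⁻¹‖, ‖((Q′G′)(Q′G′)ᴴ)⁻¹‖ ≤ nK`, then `‖((Q′G′)(Q′G′)ᴴ)⁻¹ − ((QG)(QG)ᴴ)⁻¹‖ ≤ nK·q²(2g + E)(es + ec)·nK`.
[folklore] -/
theorem opNorm_inv_gramK_sub_twoLevel_le {Q : Matrix u m ℂ} {Q' : Matrix u m' ℂ} {G : Matrix m m ℂ} {G' : Matrix m' m' ℂ}
    {J₀ : Matrix m' m ℂ} (hQ : Q' * J₀ = Q) (hK : IsUnit (Q * G * (Q * G)ᴴ).det) (hK' : IsUnit (Q' * G' * (Q' * G')ᴴ).det)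
    {q g nK es ec E : ℝ} (hQ' : ‖Q'‖ ≤ q) (hJ : ‖J₀‖ ≤ 1) (hG : ‖G‖ ≤ g) (hG' : ‖G'‖ ≤ g)
    (hN : ‖(Q * G * (Q * G)ᴴ)⁻¹‖ ≤ nK) (hN' : ‖(Q' * G' * (Q' * G')ᴴ)⁻¹‖ ≤ nK)
    (hes : ‖G' * J₀ - J₀ * G‖ ≤ es) (hec : ‖G' * (1 - J₀ * J₀ᴴ)‖ ≤ ec) (hesE : es ≤ E) :
    ‖(Q' * G' * (Q' * G')ᴴ)⁻¹ - (Q * G * (Q * G)ᴴ)⁻¹‖ ≤ nK * (q * q * (2 * g + E) * (es + ec)) * nK := by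
  have hn : 0 ≤ nK := (norm_nonneg _).trans hN
  have h3 := opNorm_gramK_sub_twoLevel_le hQ hQ' hJ hG hG' hes hec hesE
  have hS : 0 ≤ q * q * (2 * g + E) * (es + ec) := (norm_nonneg _).trans h3
  refine (opNorm_inv_sub_inv_le_of_isUnit hK' hK).trans ?_
  exact mul_le_mul (mul_le_mul hN' h3 (norm_nonneg _) hn) hN (norm_nonneg _) (mul_nonneg hn hS)

/-- the (P-gauge) operator constant: `CPtwo q g nK E := q²g·nK·(2 + q²g·nK·(2g + E))` (`E` any level-free cap of `es`). [folklore] -/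
def CPtwo (q g nK E : ℝ) : ℝ := q * q * g * nK * (2 + q * q * g * nK * (2 * g + E))

/-- `0 ≤ CPtwo q g nK` for nonnegative sizes. [folklore] -/
theorem CPtwo_nonneg {q g nK E : ℝ} (hq : 0 ≤ q) (hg : 0 ≤ g) (hn : 0 ≤ nK) (hE : 0 ≤ E) : 0 ≤ CPtwo q g nK E := by
  unfold CPtwo; positivity

/-- **THE OPERATOR TWO-LEVEL LAW OF THE GAUGE PROJECTION AGAINST THE SCALAR PLANTING** (generic finite matrices): with `Y = QG`,
`Y′ = Q′G′`, the exact averaging/planting pairing `Q′J₀ = Q`, `‖J₀‖ ≤ 1`, sizes `‖Q′‖ ≤ q`, `‖G‖, ‖G′‖ ≤ g`, unit-layer bounds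
`‖(YYᴴ)⁻¹‖, ‖(Y′Y′ᴴ)⁻¹‖ ≤ nK` (both invertible), the scalar injected number `‖G′J₀ − J₀G‖ ≤ es ≤ E` and complement number
`‖G′(1 − J₀J₀ᴴ)‖ ≤ ec`:  **`‖projY Y′·J₀ − J₀·projY Y‖ ≤ CPtwo q g nK E·(es + ec)`**. [folklore] -/
theorem opNorm_projY_twoLevel_le {Q : Matrix u m ℂ} {Q' : Matrix u m' ℂ} {G : Matrix m m ℂ} {G' : Matrix m' m' ℂ}
    {J₀ : Matrix m' m ℂ} (hQ : Q' * J₀ = Q) (hK : IsUnit (Q * G * (Q * G)ᴴ).det) (hK' : IsUnit (Q' * G' * (Q' * G')ᴴ).det)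
    {q g nK es ec E : ℝ} (hQ' : ‖Q'‖ ≤ q) (hJ : ‖J₀‖ ≤ 1) (hG : ‖G‖ ≤ g) (hG' : ‖G'‖ ≤ g)
    (hN : ‖(Q * G * (Q * G)ᴴ)⁻¹‖ ≤ nK) (hN' : ‖(Q' * G' * (Q' * G')ᴴ)⁻¹‖ ≤ nK)
    (hes : ‖G' * J₀ - J₀ * G‖ ≤ es) (hec : ‖G' * (1 - J₀ * J₀ᴴ)‖ ≤ ec) (hesE : es ≤ E) :
    ‖projY (Q' * G') * J₀ - J₀ * projY (Q * G)‖ ≤ CPtwo q g nK E * (es + ec) := by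
  have hq : 0 ≤ q := (norm_nonneg _).trans hQ'
  have hg : 0 ≤ g := (norm_nonneg _).trans hG
  have hn : 0 ≤ nK := (norm_nonneg _).trans hN
  have hes0 : 0 ≤ es := (norm_nonneg _).trans hes
  have hec0 : 0 ≤ ec := (norm_nonneg _).trans hec
  have hE : 0 ≤ E := hes0.trans hesE
  -- sizes
  have hQn : ‖Q‖ ≤ q := by
    rw [← hQ]
    calc ‖Q' * J₀‖ ≤ ‖Q'‖ * ‖J₀‖ := Matrix.l2_opNorm_mul _ _
      _ ≤ q * 1 := mul_le_mul hQ' hJ (norm_nonneg _) hq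
      _ = q := mul_one q
  have hY : ‖Q * G‖ ≤ q * g := (Matrix.l2_opNorm_mul _ _).trans (mul_le_mul hQn hG (norm_nonneg _) hq)
  have hY' : ‖Q' * G'‖ ≤ q * g := (Matrix.l2_opNorm_mul _ _).trans (mul_le_mul hQ' hG' (norm_nonneg _) hq)
  have hYH : ‖(Q * G)ᴴ‖ ≤ q * g := by rw [Matrix.l2_opNorm_conjTranspose]; exact hY
  have hY'H : ‖(Q' * G')ᴴ‖ ≤ q * g := by rw [Matrix.l2_opNorm_conjTranspose]; exact hY'
  -- the three two-level errors
  have h1 : ‖Q' * G' * J₀ - Q * G‖ ≤ q * es + 0 * g := outer_E_le hQ' hes (by rw [hQ, sub_self, norm_zero]) hG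
  rw [zero_mul, add_zero] at h1
  have h2 : ‖(Q' * G')ᴴ - J₀ * (Q * G)ᴴ‖ ≤ q * (ec + es) := by
    have e : (Q' * G')ᴴ - J₀ * (Q * G)ᴴ = (Q' * G' - Q * G * J₀ᴴ)ᴴ := by
      rw [Matrix.conjTranspose_sub, Matrix.conjTranspose_mul (Q * G), Matrix.conjTranspose_conjTranspose]
    rw [e, Matrix.l2_opNorm_conjTranspose]
    exact opNorm_outer_left_le hQ hQ' hJ hes hec
  have h4 := opNorm_inv_gramK_sub_twoLevel_le hQ hK hK' hQ' hJ hG hG' hN hN' hes hec hesE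
  -- assemble along the exact split
  rw [projY_twoLevel_split]
  have t1 : ‖J₀ * (Q * G)ᴴ * ((Q' * G' * (Q' * G')ᴴ)⁻¹ - (Q * G * (Q * G)ᴴ)⁻¹) * (Q * G)‖
      ≤ (1 * (q * g)) * (nK * (q * q * (2 * g + E) * (es + ec)) * nK) * (q * g) := by
    refine (Matrix.l2_opNorm_mul _ _).trans (mul_le_mul ((Matrix.l2_opNorm_mul _ _).trans (mul_le_mul
      ((Matrix.l2_opNorm_mul _ _).trans (mul_le_mul hJ hYH (norm_nonneg _) zero_le_one)) h4 (norm_nonneg _) (by positivity)))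
      hY (norm_nonneg _) (by positivity))
  have t2 : ‖((Q' * G')ᴴ - J₀ * (Q * G)ᴴ) * (Q' * G' * (Q' * G')ᴴ)⁻¹ * (Q * G)‖ ≤ (q * (ec + es)) * nK * (q * g) := by
    refine (Matrix.l2_opNorm_mul _ _).trans (mul_le_mul ((Matrix.l2_opNorm_mul _ _).trans (mul_le_mul h2 hN' (norm_nonneg _)
      (by positivity))) hY (norm_nonneg _) (by positivity))
  have t3 : ‖(Q' * G')ᴴ * (Q' * G' * (Q' * G')ᴴ)⁻¹ * (Q' * G' * J₀ - Q * G)‖ ≤ (q * g) * nK * (q * (es + ec)) := by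
    have h1' : ‖Q' * G' * J₀ - Q * G‖ ≤ q * (es + ec) := h1.trans (by nlinarith [mul_nonneg hq hec0])
    refine (Matrix.l2_opNorm_mul _ _).trans (mul_le_mul ((Matrix.l2_opNorm_mul _ _).trans (mul_le_mul hY'H hN' (norm_nonneg _)
      (by positivity))) h1' (norm_nonneg _) (by positivity))
  calc _ ≤ ‖J₀ * (Q * G)ᴴ * ((Q' * G' * (Q' * G')ᴴ)⁻¹ - (Q * G * (Q * G)ᴴ)⁻¹) * (Q * G)
            + ((Q' * G')ᴴ - J₀ * (Q * G)ᴴ) * (Q' * G' * (Q' * G')ᴴ)⁻¹ * (Q * G)‖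
          + ‖(Q' * G')ᴴ * (Q' * G' * (Q' * G')ᴴ)⁻¹ * (Q' * G' * J₀ - Q * G)‖ := norm_add_le _ _
    _ ≤ ((1 * (q * g)) * (nK * (q * q * (2 * g + E) * (es + ec)) * nK) * (q * g)
          + (q * (ec + es)) * nK * (q * g)) + (q * g) * nK * (q * (es + ec)) := add_le_add ((norm_add_le _ _).trans (add_le_add t1 t2)) t3
    _ = CPtwo q g nK E * (es + ec) := by unfold CPtwo; ring

/-- **THE SAME LAW FOR `gaugeP`** (Hermitian `G`, `G′`): `‖gaugeP G′ Q′·J₀ − J₀·gaugeP G Q‖ ≤ CPtwo q g nK E·(es + ec)`, the unit-layer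
bounds read on `gramK`. [cite: Balaban1985BackgroundPropagators, (3.25) p.394 (shape)] [folklore] -/
theorem opNorm_gaugeP_twoLevel_le {Q : Matrix u m ℂ} {Q' : Matrix u m' ℂ} {G : Matrix m m ℂ} {G' : Matrix m' m' ℂ}
    {J₀ : Matrix m' m ℂ} (hGh : G.IsHermitian) (hG'h : G'.IsHermitian) (hQ : Q' * J₀ = Q) (hK : IsUnit (gramK G Q).det)
    (hK' : IsUnit (gramK G' Q').det) {q g nK es ec E : ℝ} (hQ' : ‖Q'‖ ≤ q) (hJ : ‖J₀‖ ≤ 1) (hG : ‖G‖ ≤ g) (hG' : ‖G'‖ ≤ g)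
    (hN : ‖(gramK G Q)⁻¹‖ ≤ nK) (hN' : ‖(gramK G' Q')⁻¹‖ ≤ nK) (hes : ‖G' * J₀ - J₀ * G‖ ≤ es)
    (hec : ‖G' * (1 - J₀ * J₀ᴴ)‖ ≤ ec) (hesE : es ≤ E) :
    ‖gaugeP G' Q' * J₀ - J₀ * gaugeP G Q‖ ≤ CPtwo q g nK E * (es + ec) := by
  rw [gaugeP_eq_projY hGh, gaugeP_eq_projY hG'h]
  rw [gramK_eq_mul_conjTranspose hGh] at hK hN
  rw [gramK_eq_mul_conjTranspose hG'h] at hK' hN'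
  exact opNorm_projY_twoLevel_le hQ hK hK' hQ' hJ hG hG' hN hN' hes hec hesE

end TwoLevel

end Summit.QuantumFields.BalabanUV.T4Continuum.GaugeProjectionTwoLevel

end
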